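import Summits.Ventures.QEC.Census.BB.BB144Rank
import Summits.Ventures.QEC.Theses.BB144DistanceCertificate
import HarnessLib

/-!
# Route BB144DistanceCertificate, item `TwelveLogicalQubits144` (stmt-Ventures-19774): `BB.bb144.k = 12`

Closer of the support item `TwelveLogicalQubits144 : (BB.bb144).k = 12` of route
`Summits/Ventures/QEC/Theses/BB144DistanceCertificate.lean` (LADDER-QEC rung Q2, the `[[144,12,12]]` "gross" code of
Bravyi–Cross–Gambetta–Maslov–Rall–Yoder 2024, grant-milestone code): the dimension of the typed bivariate-bicycle code
`QC(x³+y+y², y³+x+x²)` on `ℤ₁₂ × ℤ₆` is `k = n − rank H^X − rank H^Z = 144 − 66 − 66 = 12`, the two ranks being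
established by kernel-checked RANK CERTIFICATES (`Summits/Ventures/QEC/Census/BB/BB144Rank.lean`, p467837: CERT-FORMAT v1
§3 `k_cert`, checker `RankCert.check` by `decide +kernel`, soundness `rank_rowMatrix_of_check` (L0); the numeral rows are
identified with `BB.bb144.HXFlat/HZFlat` entry by entry). This file only re-states `Census.bb144_k` at the route
declaration's type; it is the one file of the item allowed to import the Theses module (cell build rule).
Tier KERNEL: axioms ⊆ {propext, Classical.choice, Quot.sound}.
-/

namespace Summit.Ventures.QEC.Theorems

/-- **`k(BB144) = 12`** — route item `TwelveLogicalQubits144` (stmt-Ventures-19774) of route BB144DistanceCertificate,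
discharged by the kernel-checked rank certificates of `Census/BB/BB144Rank.lean` (`Census.bb144_k`:
`rank₂ H^X = rank₂ H^Z = 66`, `k = 144 − 66 − 66`).
[cite: BravyiEtAl2024, Extended Data Table 1 / arXiv Table 3 row [[144,12,12]] (Nature Table 1, p0003 L81) and §4 Lemma 1
(arXiv:2308.07915 chunk p0009 L66–83: k = n − rk H^X − rk H^Z)] -/
theorem TwelveLogicalQubits144_proof :
    Summit.Ventures.QEC.Theses.BB144DistanceCertificate.TwelveLogicalQubits144 := by
  unfold Summit.Ventures.QEC.Theses.BB144DistanceCertificate.TwelveLogicalQubits144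
  exact Summit.Ventures.QEC.Census.bb144_k

end Summit.Ventures.QEC.Theorems
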